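import Literature.Topology.FourManifolds.FishtailTubeDZeroSouth
import Literature.Topology.FourManifolds.FishtailTubeDZeroAngular
import Literature.Topology.FourManifolds.FishtailTubeDUpper
import Literature.Topology.FourManifolds.FishtailRadialForm
import Literature.Topology.FourManifolds.FishtailReparam
import HarnessLib

/-!
# The tube about Gompf's disc `D`

Infrastructure for the explicit fishtail neighbourhood (R. Gompf, *More Cappell–Shaneson spheres
are standard*, Algebr. Geom. Topol. 10 (2010), proof of Thm 2.1 and Lemma 2.2; the named fact
`Literature.Topology.FourManifolds.gompf2010_framedTwist`). Gompf's disc `D ⊂ X^σ` (the surgered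
section sphere minus a disc, the collar annulus, the vertical segment, the planar path, the
handle leg) is parametrised by a complex coordinate `ζ` (`ζ = 0` the centre of the south cap,
`r = ‖ζ‖` the position along `D`, `arg ζ` the base/fibre angle); the tube about it is the map
`(ζ, a, b) ↦ X^σ` obtained by gluing along `r` (`glueBy ‖ζ‖`) the eight windows

`S` (south cap chart, `tubeD0S`) | `A` (flat annulus, `tubeD0A`) | `N` (north cap chart and
puncture, `tubeD0N ∘ transDisc ∘ radMapW`) | `U5` (collar annulus) | `U4` (wall) | `U3`
(vertical segment) | `U2` (path) | `U1` (leg),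

each composed with its position function of `r` (`FishtailReparam.lean`): the latitude `nfun`
(south latitude → affine → `capLat` of the collar radius), the collar radius
`Pfun = capRad ε (nfun - 2π)`, the master angle `α = angleUp`, the height `yfun` (a monotone
blend of `footY ρ_A ∘ α` and `y_h - footY R₀ ∘ β`), the path angle `β = angleDown`, the leg
length `rL ∘ β`. This file defines `Literature.Topology.FourManifolds.tubeD` and proves the
seven junction agreements (`tubeD_agree₁` … `tubeD_agree₇`) from the plateau hypotheses.
Everything is proved; no named facts.

## References

* R. E. Gompf, *More Cappell–Shaneson spheres are standard*, Algebr. Geom. Topol. 10 (2010)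
  1665–1681, proof of Thm 2.1 and Lemma 2.2. [GompfAGT2010]
-/

noncomputable section

open scoped Real ContDiff Topology Manifold
open Set Function Filter Complex Metric

namespace Literature.Topology.FourManifolds

local notation "𝔼 " n:arg => EuclideanSpace ℝ (Fin n)

/-! ### Periodicity of the pieces in the angle -/

section Periodic

variable {ε : ℝ} (hε : 0 < ε) (hε2 : ε ≤ 1 / 2)

/-- `expT` is `2π`-periodic under `(v₀, v₁, v₂) ↦ (v₀ - 2π, v₁, v₂ + 2π)`. [folklore] -/
theorem expT_shift_two_pi (a y ℓ : ℝ) :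
    expT (WithLp.toLp 2 ![a - 2 * π, y, ℓ + 2 * π]) = expT (WithLp.toLp 2 ![a, y, ℓ]) := by
  simp only [expT]
  refine Prod.ext ?_ (Prod.ext rfl ?_)
  · show Circle.exp _ = Circle.exp _
    simp only [Matrix.cons_val_zero]
    rw [sub_eq_add_neg, Circle.exp_add, Circle.exp_neg, Circle.exp_two_pi, inv_one, mul_one]
  · show Circle.exp _ = Circle.exp _
    simp [Circle.exp_add, Circle.exp_two_pi]

/-- The physical point is `2π`-periodic in the fibre angle. [folklore] -/
theorem physX_add_two_pi (n y ℓ t : ℝ) : physX hε hε2 (n, y, ℓ + 2 * π, t) = physX hε hε2 (n, y, ℓ, t) := by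
  simp only [physX, mtCoord, physAssemble_apply]
  rw [show n - (ℓ + 2 * π) = (n - ℓ) - 2 * π by ring, expT_shift_two_pi]

/-- The chart point is `2π`-periodic in the fibre angle. [folklore] -/
theorem dchartX_add_two_pi {nj : ℝ} (P : ℂ) (y ℓ : ℝ) :
    dchartX hε hε2 nj (P, y, ℓ + 2 * π) = dchartX hε hε2 nj (P, y, ℓ) := by
  simp only [dchartX, mtCoord, aConv]
  rw [show capN ε (capD0 ε nj + P) - (ℓ + 2 * π) = (capN ε (capD0 ε nj + P) - ℓ) - 2 * π by ring, expT_shift_two_pi]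

/-- `e^{i(ϑ + 2π)} = e^{iϑ}`. [folklore] -/
theorem exp_add_two_pi_mul_I (ϑ : ℝ) : exp (((ϑ + 2 * π : ℝ) : ℂ) * I) = exp (ϑ * I) := by
  rw [ofReal_add, add_mul, Complex.exp_add]
  push_cast
  rw [exp_two_pi_mul_I, mul_one]

variable {nj ρA R₀ yh t₀ cL ρb : ℝ} {V : VertProfile} {μL : ℝ → ℝ}

/-- U5 is `2π`-periodic in the angle. [folklore] -/
theorem pieceU5_add_two_pi (q : ℝ × ℝ × ℝ × ℝ) :
    pieceU5 hε hε2 nj ρA (q.1, q.2.1 + 2 * π, q.2.2) = pieceU5 hε hε2 nj ρA q := by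
  simp only [pieceU5, shellTubeMap, profTubeMap, profTube]
  rw [exp_add_two_pi_mul_I, show q.2.1 + 2 * π - q.2.2.2 = (q.2.1 - q.2.2.2) + 2 * π by ring, dchartX_add_two_pi]

/-- U4 is `2π`-periodic in the angle. [folklore] -/
theorem pieceU4_add_two_pi (q : ℝ × ℝ × ℝ × ℝ) :
    pieceU4 hε hε2 nj ρA (q.1, q.2.1 + 2 * π, q.2.2) = pieceU4 hε hε2 nj ρA q := by
  simp only [pieceU4, tubeUpMap, tubeUp]
  rw [exp_add_two_pi_mul_I, show q.2.1 + 2 * π - chiU ρA q.1 * q.2.2.2 = (q.2.1 - chiU ρA q.1 * q.2.2.2) + 2 * π by ring,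
    dchartX_add_two_pi]

/-- U3 is `2π`-periodic in the angle. [folklore] -/
theorem pieceU3_add_two_pi (q : ℝ × ℝ × ℝ × ℝ) :
    pieceU3 hε hε2 nj V (q.1, q.2.1 + 2 * π, q.2.2) = pieceU3 hε hε2 nj V q := by
  simp only [pieceU3, vertCore]
  rw [exp_add_two_pi_mul_I, physX_add_two_pi]

/-- U2 is `2π`-periodic in the angle. [folklore] -/
theorem pieceU2_add_two_pi (q : ℝ × ℝ × ℝ × ℝ) :
    pieceU2 hε hε2 nj R₀ yh t₀ (q.1, q.2.1 + 2 * π, q.2.2) = pieceU2 hε hε2 nj R₀ yh t₀ q := by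
  have hrot : rotAB (q.2.1 + 2 * π) q.2.2.1 q.2.2.2 = rotAB q.2.1 q.2.2.1 q.2.2.2 := by
    simp [rotAB, Real.sin_add_two_pi, Real.cos_add_two_pi]
  simp only [pieceU2, pathTubeMap, hrot]
  exact physX_add_two_pi hε hε2 _ _ _ _

/-- U1 is `2π`-periodic in the angle. [folklore] -/
theorem pieceU1_add_two_pi (q : ℝ × ℝ × ℝ × ℝ) :
    pieceU1 hε hε2 nj yh cL ρb μL (q.1, q.2.1 + 2 * π, q.2.2) = pieceU1 hε hε2 nj yh cL ρb μL q := by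
  simp only [pieceU1, legTubeMap]
  rw [exp_add_two_pi_mul_I]
  exact physX_add_two_pi hε hε2 _ _ _ _

variable {δ lam c : ℝ} {kapS μS : ℝ → ℝ} {nA nB : ℝ}

/-- The angular `D⁰` tube is `2π`-periodic in the angle. [folklore] -/
theorem tubeD0A_add_two_pi (q : ℝ × ℝ × ℝ × ℝ) :
    tubeD0A hε hε2 δ lam c kapS μS nA nB (q.1, q.2.1 + 2 * π, q.2.2) = tubeD0A hε hε2 δ lam c kapS μS nA nB q := by
  simp only [tubeD0A, glue2]
  have h2 : zoneS2 kapS (q.1, q.2.1 + 2 * π, q.2.2) = zoneS2 kapS q := twoChart_add_two_pi q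
  have h3 : zoneS3 μS lam (q.1, q.2.1 + 2 * π, q.2.2) = zoneS3 μS lam q := twoChart_add_two_pi q
  have hM : zoneM δ lam c (q.1, q.2.1 + 2 * π, q.2.2) = zoneM δ lam c q := twoChart_add_two_pi q
  simp only [pieceA2, pieceA3, pieceAM, h2, h3, hM]

/-- The flat-annulus zone is `2π`-periodic in the LATITUDE. [folklore] -/
theorem zoneM_add_two_pi_lat (q : ℝ × ℝ × ℝ × ℝ) : zoneM δ lam c (q.1 + 2 * π, q.2) = zoneM δ lam c q := by
  simp only [zoneM_apply]
  have he : Circle.exp (q.1 + 2 * π) = Circle.exp q.1 := by rw [Circle.exp_add, Circle.exp_two_pi, mul_one]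
  have hℓ : ∀ s b, midEll c δ lam (q.1 + 2 * π) s b = midEll c δ lam q.1 s b := fun s b ↦ by
    simp only [midEll, he]
  simp only [midT3, hℓ, he]

end Periodic

/-! ### The parameters and the tube -/

section TubeD

/-- **The data of the tube about Gompf's disc.** [folklore] -/
structure TubeDData where
  /-- tube radius of the surgery -/ ε : ℝ
  hε : 0 < ε
  hε2 : ε ≤ 1 / 2
  /-- latitude of the puncture -/ nj : ℝ
  /-- half-width of the base step -/ δ : ℝ
  /-- blend radii of the section about the puncture -/ rσ₁ : ℝ
  rσ₂ : ℝ
  rσ₃ : ℝ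
  /-- the constant scale of the offsets over `D⁰` and `A` -/ lam : ℝ
  /-- cone constants at the cap centres -/ cN : ℝ
  cS : ℝ
  /-- scale and switch profiles -/ kapN : ℝ → ℝ
  kapS : ℝ → ℝ
  μN : ℝ → ℝ
  μS : ℝ → ℝ
  /-- glue radius north/flat annulus -/ RM : ℝ
  /-- latitudes of the south glue -/ nA : ℝ
  nB : ℝ
  /-- translation disc radii and the Lipschitz constant of the smooth transition -/ R₁ : ℝ
  R₂ : ℝ
  C : ℝ
  hC : ∀ x, ‖deriv Real.smoothTransition x‖ ≤ C
  hR₁ : 0 ≤ R₁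
  hR₁₂ : R₁ < R₂
  hroom : 4 * C * R₂ * ‖capD0 ε nj‖ ≤ R₂ ^ 2 - R₁ ^ 2
  /-- the latitude profile `discLat ε n₁ k ρ₁ ρa ρb` and its blend `[a₂, b₂]` into the collar -/ n₁ : ℝ
  k : ℝ
  ρ₁ : ℝ
  ρa : ℝ
  ρb : ℝ
  a₂ : ℝ
  b₂ : ℝ
  /-- master angle shifts -/ r₀ : ℝ
  r₁ : ℝ
  /-- collar annulus radius, path radius, hole height, leg data -/ ρA : ℝ
  R₀ : ℝ
  yh : ℝ
  cL : ℝ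
  ρbL : ℝ
  μL : ℝ → ℝ
  /-- the vertical profile -/ V : VertProfile
  /-- the height blend `[a₆, b₆]` -/ a₆ : ℝ
  b₆ : ℝ
  /-- the leg-position blend `[a₈, b₈]` (from `rL ∘ β` to the identity) -/ a₈ : ℝ
  b₈ : ℝ
  /-- the seven glue radii -/ s₁ : ℝ
  s₂ : ℝ
  s₃ : ℝ
  s₄ : ℝ
  s₅ : ℝ
  s₆ : ℝ
  s₇ : ℝ

namespace TubeDData

variable (T : TubeDData)

/-- The cut latitude of the winding section (at the puncture). [folklore] -/
def cut : ℝ := T.nj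

/-- The translation diffeomorphism of the chart plane (by `d₀ = capD0 ε nj`). [folklore] -/
def tdisc : ℂ ≃ₘ⟮𝓘(ℝ, ℂ), 𝓘(ℝ, ℂ)⟯ ℂ := transDisc (d₀ := capD0 T.ε T.nj) T.hC T.hR₁ T.hR₁₂ T.hroom

/-- The master angle (increasing). [folklore] -/
def α (r : ℝ) : ℝ := angleUp T.r₀ r

/-- The path angle (decreasing). [folklore] -/
def β (r : ℝ) : ℝ := angleDown T.r₁ r

/-- **The latitude profile**: south latitude → affine → `capLat` of the collar radius `ρ_A (3 - tan α)` (`+ 2π`). [folklore] -/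
def nfun : ℝ → ℝ :=
  blendFun (stdBlend T.a₂ T.b₂) (discLat T.ε T.n₁ T.k T.ρ₁ T.ρa T.ρb)
    (fun r ↦ capLat T.ε (flatU T.ρA (T.α r)) + 2 * π)

/-- The collar radius in the north chart. [folklore] -/
def Pfun (r : ℝ) : ℝ := capRad T.ε (T.nfun r - 2 * π)

/-- **The height profile**: `footY ρ_A ∘ α` blended into `y_h - footY R₀ ∘ β`. [folklore] -/
def yfun : ℝ → ℝ :=
  blendFun (stdBlend T.a₆ T.b₆) (fun r ↦ footY T.ρA (T.α r)) (fun r ↦ T.yh - footY T.R₀ (T.β r))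

/-- The leg length as a function of the path angle. [folklore] -/
def rL (β : ℝ) : ℝ := (bxH * (T.cL * T.ρbL) - 1 / 4 + T.R₀ - T.R₀ * Real.tan β) / bxH

/-- **The leg position**: `rL ∘ β` blended into the identity (so that next to the corner the
position along the leg is `r = |ζ|` itself). [folklore] -/
def posL : ℝ → ℝ := blendFun (stdBlend T.a₈ T.b₈) (fun r ↦ T.rL (T.β r)) fun r ↦ r

/-- The base of the path's affine image. [folklore] -/
def t₀ : ℝ := 3 / 4 - 2 * T.R₀

/-- Window S: the south cap chart (`d_S = ζ`). [folklore] -/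
def winS (q : ℂ × ℝ × ℝ) : (fishNu T.hε T.hε2).Surgered := tubeD0S T.hε T.hε2 T.cS T.kapS q

/-- Window A: the flat annulus, latitude `nfun ‖ζ‖`. [folklore] -/
def winA : ℂ × ℝ × ℝ → (fishNu T.hε T.hε2).Surgered :=
  radialForm T.nfun (tubeD0A T.hε T.hε2 T.δ T.lam T.cut T.kapS T.μS T.nA T.nB)

/-- Window N: the north chart, position `tdisc (Pfun ‖ζ‖ e^{i arg ζ})`. [folklore] -/
def winN (q : ℂ × ℝ × ℝ) : (fishNu T.hε T.hε2).Surgered :=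
  tubeD0N T.hε T.hε2 (capTj T.ε T.nj) T.δ T.rσ₁ T.rσ₂ T.rσ₃ T.lam T.cN T.kapN T.μN T.cut T.RM
    (T.tdisc (radMapW T.Pfun q).1, q.2)

/-- Window U5: the collar annulus, angle `α ‖ζ‖`, offsets scaled by `λ`. [folklore] -/
def winU5 : ℂ × ℝ × ℝ → (fishNu T.hε T.hε2).Surgered :=
  radialForm T.α fun p ↦ pieceU5 T.hε T.hε2 T.nj T.ρA (p.1, p.2.1, T.lam * p.2.2.1, T.lam * p.2.2.2)

/-- Window U4: the wall, height `footY ρ_A (α ‖ζ‖)`. [folklore] -/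
def winU4 : ℂ × ℝ × ℝ → (fishNu T.hε T.hε2).Surgered :=
  radialForm (fun r ↦ footY T.ρA (T.α r)) fun p ↦ pieceU4 T.hε T.hε2 T.nj T.ρA (p.1, p.2.1, T.lam * p.2.2.1, T.lam * p.2.2.2)

/-- Window U3: the vertical segment, height `yfun ‖ζ‖`. [folklore] -/
def winU3 : ℂ × ℝ × ℝ → (fishNu T.hε T.hε2).Surgered :=
  radialForm T.yfun fun p ↦ pieceU3 T.hε T.hε2 T.nj T.V (p.1, p.2.1, T.lam * p.2.2.1, T.lam * p.2.2.2)

/-- Window U2: the path, angle `β ‖ζ‖`, raw offsets. [folklore] -/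
def winU2 : ℂ × ℝ × ℝ → (fishNu T.hε T.hε2).Surgered :=
  radialForm T.β (pieceU2 T.hε T.hε2 T.nj T.R₀ T.yh T.t₀)

/-- Window U1: the leg, position `posL ‖ζ‖`, raw offsets. [folklore] -/
def winU1 : ℂ × ℝ × ℝ → (fishNu T.hε T.hε2).Surgered :=
  radialForm T.posL (pieceU1 T.hε T.hε2 T.nj T.yh T.cL T.ρbL T.μL)

/-- **The tube about Gompf's disc.** [cite: GompfAGT2010, Lemma 2.2 (proof: the boundary of a tubular neighbourhood of D)] -/
def tubeD : ℂ × ℝ × ℝ → (fishNu T.hε T.hε2).Surgered :=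
  glueBy (fun q ↦ ‖q.1‖) T.s₁ T.winS (glueBy (fun q ↦ ‖q.1‖) T.s₂ T.winA (glueBy (fun q ↦ ‖q.1‖) T.s₃ T.winN
    (glueBy (fun q ↦ ‖q.1‖) T.s₄ T.winU5 (glueBy (fun q ↦ ‖q.1‖) T.s₅ T.winU4 (glueBy (fun q ↦ ‖q.1‖) T.s₆ T.winU3
      (glueBy (fun q ↦ ‖q.1‖) T.s₇ T.winU2 T.winU1))))))

end TubeDData

/-! ### The junction agreements -/

namespace TubeDData

variable (T : TubeDData)

/-- The angle of a positive multiple of `e^{iθ}`, `θ = arg ζ`. [folklore] -/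
theorem arg_pos_mul_exp_arg {P : ℝ} (hP : 0 < P) (ζ : ℂ) : arg ((P : ℂ) * exp (arg ζ * I)) = arg ζ := by
  rw [arg_real_mul _ hP]
  have := arg_exp_mul_I_eq (ϑ := arg ζ) (k := 0) (by simp; linarith [neg_pi_lt_arg ζ]) (by simp; exact arg_le_pi ζ)
  simpa using this

/-- `capS d = baseOf d` when `im d < 0`. [folklore] -/
theorem capS_eq_baseOf_of_im_neg {d : ℂ} (h : d.im < 0) : capS d = baseOf d := by
  rcases capS_eq_baseOf_or d with h1 | ⟨h1, h2⟩
  · exact h1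
  · -- then `arg d ≥ π/2`…: `baseOf d = capS d - 1 = arg d/(2π)` forces `arg d > π/2 > 0`, contradicting `im d < 0`
    exfalso
    have ha : arg d < 0 := arg_neg_iff.2 h
    have hb := (baseOf_mem d).1
    rw [capS] at h1
    have : arg d / (2 * π) = baseOf d := by linarith
    have hπ := Real.pi_pos
    have : arg d / (2 * π) < 0 := div_neg_of_neg_of_pos ha (by positivity)
    linarith

/-- **Agreement 1 (south chart | flat annulus)**: where `‖ζ‖ ≥ 1/2`, the latitude profile is the
south latitude (`stdBlend a₂ b₂ = 0`, `discLat = southLat`) and below `nA`. [folklore] -/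
theorem agree₁ {q : ℂ × ℝ × ℝ} (hhalf : 1 / 2 ≤ ‖q.1‖) (hb : stdBlend T.a₂ T.b₂ ‖q.1‖ = 0)
    (hdisc : discLat T.ε T.n₁ T.k T.ρ₁ T.ρa T.ρb ‖q.1‖ = southLat T.ε ‖q.1‖) (hnA : T.nfun ‖q.1‖ < T.nA) :
    T.winS q = T.winA q := by
  have hn : T.nfun ‖q.1‖ = -capN T.ε q.1 := by
    rw [nfun, blendFun_of_zero hb, hdisc, southLat, capN]
  rw [winS, tubeD0S, glueBy_of_le (τ := fun q : ℂ × ℝ × ℝ ↦ ‖q.1‖) hhalf, winA, radialForm_apply, tubeD0A,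
    glue2_of_lt (by exact hnA)]
  simp only [pieceS2, pieceA2, polarForm_apply, zoneS2n, hn]
  rfl

/-- **Agreement 2 (flat annulus | north chart)**: where the latitude is `≥ nB`, the collar radius
`P ≥ max R₂ RM` (translation trivial, zone `M`), `(n - 2π)² < ε²`. [folklore] -/
theorem agree₂ {q : ℂ × ℝ × ℝ} (hAB : T.nA ≤ T.nB) (hnB : T.nB ≤ T.nfun ‖q.1‖) (hP2 : T.R₂ ≤ T.Pfun ‖q.1‖)
    (hRM : T.RM ≤ T.Pfun ‖q.1‖) (hRM0 : 83 / 100 ≤ T.RM) (hn : (T.nfun ‖q.1‖ - 2 * π) ^ 2 < T.ε ^ 2) :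
    T.winA q = T.winN q := by
  have hP0 : 0 < T.Pfun ‖q.1‖ := by linarith
  have hnorm : ‖(radMapW T.Pfun q).1‖ = T.Pfun ‖q.1‖ := by rw [norm_radMapW_fst, abs_of_pos hP0]
  have htd : T.tdisc (radMapW T.Pfun q).1 = (radMapW T.Pfun q).1 := by
    rw [tdisc, transDisc_of_le_norm T.hC T.hR₁ T.hR₁₂ T.hroom (by rw [hnorm]; exact hP2)]
  rw [winA, radialForm_apply, tubeD0A, glue2_of_le (show T.nA ≤ (T.nfun ‖q.1‖, arg q.1, q.2).1 by
    simp only; linarith), glue2_of_le (by exact hnB), winN, htd, tubeD0N]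
  rw [glueBy_of_le (τ := fun q : ℂ × ℝ × ℝ ↦ ‖q.1‖) (by show 1 / 2 ≤ ‖(radMapW T.Pfun q).1‖; rw [hnorm]; linarith),
    glueBy_of_le (τ := fun q : ℂ × ℝ × ℝ ↦ ‖q.1‖) (by show 13 / 20 ≤ ‖(radMapW T.Pfun q).1‖; rw [hnorm]; linarith),
    glueBy_of_le (τ := fun q : ℂ × ℝ × ℝ ↦ ‖q.1‖) (by show 4 / 5 ≤ ‖(radMapW T.Pfun q).1‖; rw [hnorm]; linarith),
    glueBy_of_le (τ := fun q : ℂ × ℝ × ℝ ↦ ‖q.1‖) (by show T.RM ≤ ‖(radMapW T.Pfun q).1‖; rw [hnorm]; exact hRM)]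
  simp only [pieceAM, pieceM, polarForm_apply, radMapW_apply]
  rw [arg_pos_mul_exp_arg hP0, capN, show ‖((T.Pfun ‖q.1‖ : ℝ) : ℂ) * exp (arg q.1 * I)‖ = T.Pfun ‖q.1‖ by
    simpa [radMapW_apply] using hnorm, Pfun, capLat_capRad T.hε hn]
  congr 1
  have := zoneM_add_two_pi_lat (δ := T.δ) (lam := T.lam) (c := T.cut) (T.nfun ‖q.1‖ - 2 * π, arg q.1, q.2)
  rw [show T.nfun ‖q.1‖ - 2 * π + 2 * π = T.nfun ‖q.1‖ by ring] at this
  simp only at this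
  exact this

/-- `unitC` of a positive multiple of `e^{i arg ζ}` is `e^{i arg ζ}`. [folklore] -/
theorem unitC_pos_mul_exp_arg {P : ℝ} (hP : 0 < P) (ζ : ℂ) : unitC ((P : ℂ) * exp (arg ζ * I)) = Circle.exp (arg ζ) := by
  rw [unitC, arg_pos_mul_exp_arg hP]

/-- **Agreement 3 (north chart | collar annulus)**: where the latitude blend is complete
(`stdBlend a₂ b₂ = 1`, so `P = ρ_A (3 - tan α)`), `0 < P ≤ R₁` (translation by `d₀`), `P < t_j`,
the point `d = d₀ + P e^{iθ}` lies in zone `N4` (`4/5 ≤ ‖d‖ < RM`) with `σ_C(d) = (d - d₀)/|d - d₀|`,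
and the collar shell is on its flat plateau (`-π/2 < α ≤ 0`). [folklore] -/
theorem agree₃ (hρA : 0 < T.ρA) {q : ℂ × ℝ × ℝ} (hb : stdBlend T.a₂ T.b₂ ‖q.1‖ = 1) (hP0 : 0 < T.Pfun ‖q.1‖)
    (hP1 : T.Pfun ‖q.1‖ ≤ T.R₁) (hPtj : T.Pfun ‖q.1‖ < capTj T.ε T.nj)
    (hz1 : 4 / 5 ≤ ‖capD0 T.ε T.nj + (T.Pfun ‖q.1‖ : ℂ) * exp (arg q.1 * I)‖)
    (hz2 : ‖capD0 T.ε T.nj + (T.Pfun ‖q.1‖ : ℂ) * exp (arg q.1 * I)‖ < T.RM)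
    (hσ : sigmaCapC (capTj T.ε T.nj) T.δ T.rσ₁ T.rσ₂ T.rσ₃ (capD0 T.ε T.nj + (T.Pfun ‖q.1‖ : ℂ) * exp (arg q.1 * I)) =
      unitC ((T.Pfun ‖q.1‖ : ℂ) * exp (arg q.1 * I)))
    (hα0 : T.α ‖q.1‖ ≤ 0) (hα1 : -(π / 2) < T.α ‖q.1‖) : T.winN q = T.winU5 q := by
  set θ := arg q.1 with hθ
  set P := T.Pfun ‖q.1‖ with hPdef
  set d : ℂ := capD0 T.ε T.nj + (P : ℂ) * exp (θ * I) with hd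
  -- the collar radius is the flat abscissa of the shell
  have hPflat : P = flatU T.ρA (T.α ‖q.1‖) := by
    rw [hPdef, Pfun, nfun, blendFun_of_one hb, show capLat T.ε (flatU T.ρA (T.α ‖q.1‖)) + 2 * π - 2 * π =
      capLat T.ε (flatU T.ρA (T.α ‖q.1‖)) by ring, capRad_capLat T.hε]
  have hnorm : ‖(radMapW T.Pfun q).1‖ = P := by rw [norm_radMapW_fst, abs_of_pos hP0]
  have htd : T.tdisc (radMapW T.Pfun q).1 = d := by
    rw [tdisc, transDisc_of_norm_le T.hC T.hR₁ T.hR₁₂ T.hroom (by rw [hnorm]; exact hP1), radMapW_apply, hd, add_comm]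
  -- `im d < 0`, in particular `d ≠ 0`
  have him : d.im < 0 := by
    rw [hd, add_im, capD0_im]
    have : |((P : ℂ) * exp (θ * I)).im| ≤ ‖(P : ℂ) * exp (θ * I)‖ := abs_im_le_norm _
    rw [show ‖(P : ℂ) * exp (θ * I)‖ = P by simp [norm_exp_ofReal_mul_I, abs_of_pos hP0]] at this
    have := (abs_le.1 this).2
    linarith
  have hd0 : d ≠ 0 := fun h ↦ by rw [h] at him; simp at him
  -- the north side: zone `N4`
  have hN : T.winN q = toSurg (fishNu T.hε T.hε2)
      (mtPt tubeShearDiffeo (northT3 T.ε (capTj T.ε T.nj) T.δ T.rσ₁ T.rσ₂ T.rσ₃ T.lam d q.2.1 q.2.2) (baseOf d)) := by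
    rw [winN, htd, tubeD0N, glueBy_of_le (τ := fun q : ℂ × ℝ × ℝ ↦ ‖q.1‖) (show 1 / 2 ≤ ‖d‖ by linarith),
      glueBy_of_le (τ := fun q : ℂ × ℝ × ℝ ↦ ‖q.1‖) (show 13 / 20 ≤ ‖d‖ by linarith),
      glueBy_of_le (τ := fun q : ℂ × ℝ × ℝ ↦ ‖q.1‖) (show 4 / 5 ≤ ‖d‖ from hz1),
      glueBy_of_lt (τ := fun q : ℂ × ℝ × ℝ ↦ ‖q.1‖) (show ‖d‖ < T.RM from hz2)]
    simp only [pieceN4, polarForm_apply, zoneN4_apply]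
    rw [baseOf_exp_arg hd0, capPt_capN_baseOf T.hε]
  -- the collar side: flat plateau of the shell
  have hshell : pathShell T.ρA (T.α ‖q.1‖, T.lam * q.2.1) = (P, T.lam * q.2.1) := by
    rw [pathShell_eq_flat hρA (q := (T.α ‖q.1‖, T.lam * q.2.1)) (show T.α ‖q.1‖ < π / 6 by linarith [Real.pi_pos]),
      hPflat]
    have htan : Real.tan (T.α ‖q.1‖) ≤ 0 := by
      rw [Real.tan_eq_sin_div_cos]
      exact div_nonpos_of_nonpos_of_nonneg (Real.sin_nonpos_of_nonpos_of_neg_pi_le hα0 (by linarith [Real.pi_pos]))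
        (Real.cos_nonneg_of_mem_Icc ⟨by linarith, by linarith [Real.pi_pos]⟩)
    have hge : 3 * T.ρA ≤ flatU T.ρA (T.α ‖q.1‖) := by rw [flatU]; nlinarith
    exact flatPt_of_ge hρA hge _
  have hU : T.winU5 q = toSurg (fishNu T.hε T.hε2)
      (mtCoord tubeShearDiffeo (aConv T.ε T.nj ((P : ℂ) * exp (θ * I), T.lam * q.2.1, θ - T.lam * q.2.2))) := by
    rw [winU5, radialForm_apply]
    simp only [pieceU5, dchartX, shellTubeMap, profTubeMap, profTube, hshell, hθ]
  rw [hN, hU]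
  congr 1
  -- compare the two mapping-torus points
  rw [mtCoord]
  have hs : (aConv T.ε T.nj ((P : ℂ) * exp (θ * I), T.lam * q.2.1, θ - T.lam * q.2.2)).2 = baseOf d := by
    simp only [aConv]
    rw [← hd]
    exact capS_eq_baseOf_of_im_neg him
  rw [hs]
  congr 1
  -- the `T³` points
  have hz3 : northZ3 (capTj T.ε T.nj) T.δ T.rσ₁ T.rσ₂ T.rσ₃ T.lam d q.2.2 = Circle.exp (θ - T.lam * q.2.2) := by
    rw [northZ3, hσ, unitC_pos_mul_exp_arg hP0, ← Circle.exp_add, sub_eq_add_neg]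
  simp only [northT3, hz3, aConv, expT]
  refine Prod.ext ?_ (Prod.ext ?_ ?_)
  · show Circle.exp (capN T.ε d) * (Circle.exp (θ - T.lam * q.2.2))⁻¹ = Circle.exp _
    simp only [Matrix.cons_val_zero]
    rw [← hd, sub_eq_add_neg (capN T.ε d), Circle.exp_add, Circle.exp_neg]
  · simp
  · simp

/-- **Agreement 4 (collar annulus | wall)**: on the foot of the collar (`π/3 < α`,
`footY ρ_A α ≤ 11 ρ_A/5`) where the height blend has not started (`stdBlend a₆ b₆ = 0`). [folklore] -/
theorem agree₄ (hρA : 0 < T.ρA) {q : ℂ × ℝ × ℝ} (hα : π / 3 < T.α ‖q.1‖) (hy : footY T.ρA (T.α ‖q.1‖) ≤ 11 * T.ρA / 5) :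
    T.winU5 q = T.winU4 q := by
  rw [winU5, winU4, radialForm_apply, radialForm_apply]
  exact pieceU5_eq_pieceU4 T.hε T.hε2 hρA (q := (T.α ‖q.1‖, arg q.1, T.lam * q.2.1, T.lam * q.2.2)) hα hy

/-- **Agreement 5 (wall | vertical segment)**: `4 ρ_A ≤ y = footY ρ_A α` (height blend not started)
and the vertical profile on its bottom plateau at `y`. [folklore] -/
theorem agree₅ (hρA : 0 < T.ρA) {q : ℂ × ℝ × ℝ} (hb : stdBlend T.a₆ T.b₆ ‖q.1‖ = 0) (hy : 4 * T.ρA ≤ footY T.ρA (T.α ‖q.1‖))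
    (hm : T.V.m (footY T.ρA (T.α ‖q.1‖)) = 1) (hθ : T.V.θ (footY T.ρA (T.α ‖q.1‖)) = 0)
    (h1 : T.V.σ₁ (footY T.ρA (T.α ‖q.1‖)) = 1) (h2 : T.V.σ₂ (footY T.ρA (T.α ‖q.1‖)) = 1) : T.winU4 q = T.winU3 q := by
  have hyfun : T.yfun ‖q.1‖ = footY T.ρA (T.α ‖q.1‖) := by rw [yfun, blendFun_of_zero hb]
  rw [winU4, winU3, radialForm_apply, radialForm_apply, hyfun]
  exact pieceU4_eq_pieceU3 T.hε T.hε2 hρA (q := (footY T.ρA (T.α ‖q.1‖), arg q.1, T.lam * q.2.1, T.lam * q.2.2)) hy hm hθ h1 h2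

/-- **Agreement 6 (vertical segment | path)**: height blend complete (`stdBlend a₆ b₆ = 1`, so
`y = y_h - footY R₀ β`), path on its foot plateau (`π/3 < β`, `2R₀ ≤ footY R₀ β`), vertical profile
on its top plateau at `y` with the scale `λ`. [folklore] -/
theorem agree₆ (hnj : T.nj ^ 2 < T.ε ^ 2) (hnj0 : T.nj < 0) (hR : 0 < T.R₀) (hlam : T.lam ≠ 0) {q : ℂ × ℝ × ℝ}
    (hb : stdBlend T.a₆ T.b₆ ‖q.1‖ = 1) (hβ : π / 3 < T.β ‖q.1‖) (hy' : 2 * T.R₀ ≤ footY T.R₀ (T.β ‖q.1‖))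
    (hm : T.V.m (T.yh - footY T.R₀ (T.β ‖q.1‖)) = 0) (hθ : T.V.θ (T.yh - footY T.R₀ (T.β ‖q.1‖)) = π / 2)
    (h1 : T.V.σ₁ (T.yh - footY T.R₀ (T.β ‖q.1‖)) = 1 / (T.lam * capCL T.ε T.nj))
    (h2 : T.V.σ₂ (T.yh - footY T.R₀ (T.β ‖q.1‖)) = 2 * π * capTj T.ε T.nj / T.lam) : T.winU3 q = T.winU2 q := by
  have hyfun : T.yfun ‖q.1‖ = T.yh - footY T.R₀ (T.β ‖q.1‖) := by rw [yfun, blendFun_of_one hb]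
  rw [winU3, winU2, radialForm_apply, radialForm_apply, hyfun]
  exact pieceU3_eq_pieceU2 T.hε T.hε2 T.hε hnj hnj0 hR rfl hlam hβ hy' hm hθ h1 h2

/-- **Agreement 7 (path | leg)**: `-π/2 < β ≤ 0` (flat plateau) and `μ_L (r_L β) = 0`. [folklore] -/
theorem agree₇ (hR : 0 < T.R₀) {q : ℂ × ℝ × ℝ} (hb : stdBlend T.a₈ T.b₈ ‖q.1‖ = 0) (hβ0 : -(π / 2) < T.β ‖q.1‖)
    (hβ : T.β ‖q.1‖ ≤ 0) (hμ : T.μL (T.rL (T.β ‖q.1‖)) = 0) : T.winU2 q = T.winU1 q := by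
  have hpos : T.posL ‖q.1‖ = T.rL (T.β ‖q.1‖) := by rw [posL, blendFun_of_zero hb]
  rw [winU2, winU1, radialForm_apply, radialForm_apply, hpos]
  exact pieceU2_eq_pieceU1 T.hε T.hε2 hR rfl hβ0 hβ (by exact hμ)

end TubeDData

/-! ### Gluing with agreement on an open set only -/

section GlueOpen

variable {E H : Type*} [NormedAddCommGroup E] [NormedSpace ℝ E] [TopologicalSpace H] {J : ModelWithCorners ℝ E H}
  {N : Type*} [TopologicalSpace N] [ChartedSpace H N]
  {F : Type*} [NormedAddCommGroup F] [NormedSpace ℝ F]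
  {τ : F → ℝ} {s : ℝ} {f g : F → N}

/-- **The glued map is a local diffeomorphism** at `q ∈ S`, `S` open, when the pieces agree on the
slab `|τ - s| < δ` inside `S` only. [folklore] -/
theorem isLocalDiffeomorphAt_glueBy_of_open (hτ : Continuous τ) {δ : ℝ} (hδ : 0 < δ) {S : Set F} (hS : IsOpen S) {q : F}
    (hq : q ∈ S) (hfg : ∀ q' ∈ S, |τ q' - s| < δ → f q' = g q')
    (hf : τ q < s → IsLocalDiffeomorphAt 𝓘(ℝ, F) J ∞ f q) (hg : s - δ < τ q → IsLocalDiffeomorphAt 𝓘(ℝ, F) J ∞ g q) :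
    IsLocalDiffeomorphAt 𝓘(ℝ, F) J ∞ (glueBy τ s f g) q := by
  rcases lt_or_ge (τ q) (s - δ / 2) with hl | hr
  · have ho : IsOpen {q' : F | τ q' < s} := isOpen_lt hτ continuous_const
    exact isLocalDiffeomorphAt_congr_nhds' (hf (by linarith))
      (eventuallyEq_of_mem (ho.mem_nhds (show τ q < s by linarith)) fun q' hq' ↦ glueBy_of_lt hq')
  · refine isLocalDiffeomorphAt_congr_nhds' (hg (by linarith)) ?_
    rcases lt_or_ge (τ q) (s + δ / 2) with hm | hbig
    · have ho : IsOpen {q' : F | |τ q' - s| < δ} := isOpen_lt (continuous_abs.comp (hτ.sub continuous_const)) continuous_const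
      filter_upwards [ho.mem_nhds (show |τ q - s| < δ from abs_lt.2 ⟨by linarith, by linarith⟩), hS.mem_nhds hq] with q' h1 h2
      rcases lt_or_ge (τ q') s with hl' | hr'
      · rw [glueBy_of_lt hl', hfg q' h2 h1]
      · exact glueBy_of_le hr'
    · have ho : IsOpen {q' : F | s < τ q'} := isOpen_lt continuous_const hτ
      exact eventuallyEq_of_mem (ho.mem_nhds (show s < τ q by linarith)) fun q' hq' ↦ glueBy_of_le (le_of_lt hq')

end GlueOpen

/-! ### The tube is a local diffeomorphism -/

namespace TubeDData

variable (T : TubeDData)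

/-- **Hypotheses for the seven-fold glue**: a slab half-width `η`, ordered glue radii, an open set
`Adm` of admissible offsets, the agreements on the slabs at admissible offsets, and the local
diffeomorphism property of each window on its range (with margins) at admissible offsets. [folklore] -/
structure GlueHyp (η rmax : ℝ) (Adm : Set (ℝ × ℝ)) : Prop where
  hη : 0 < η
  hAdm : IsOpen Adm
  h01 : η < T.s₁
  h12 : T.s₁ + η ≤ T.s₂ - η
  h23 : T.s₂ + η ≤ T.s₃ - η
  h34 : T.s₃ + η ≤ T.s₄ - η
  h45 : T.s₄ + η ≤ T.s₅ - η
  h56 : T.s₅ + η ≤ T.s₆ - η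
  h67 : T.s₆ + η ≤ T.s₇ - η
  h7 : T.s₇ + η ≤ rmax
  ag₁ : ∀ q : ℂ × ℝ × ℝ, q.2 ∈ Adm → |‖q.1‖ - T.s₁| < η → T.winS q = T.winA q
  ag₂ : ∀ q : ℂ × ℝ × ℝ, q.2 ∈ Adm → |‖q.1‖ - T.s₂| < η → T.winA q = T.winN q
  ag₃ : ∀ q : ℂ × ℝ × ℝ, q.2 ∈ Adm → |‖q.1‖ - T.s₃| < η → T.winN q = T.winU5 q
  ag₄ : ∀ q : ℂ × ℝ × ℝ, q.2 ∈ Adm → |‖q.1‖ - T.s₄| < η → T.winU5 q = T.winU4 q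
  ag₅ : ∀ q : ℂ × ℝ × ℝ, q.2 ∈ Adm → |‖q.1‖ - T.s₅| < η → T.winU4 q = T.winU3 q
  ag₆ : ∀ q : ℂ × ℝ × ℝ, q.2 ∈ Adm → |‖q.1‖ - T.s₆| < η → T.winU3 q = T.winU2 q
  ag₇ : ∀ q : ℂ × ℝ × ℝ, q.2 ∈ Adm → |‖q.1‖ - T.s₇| < η → T.winU2 q = T.winU1 q
  ldS : ∀ q : ℂ × ℝ × ℝ, q.2 ∈ Adm → ‖q.1‖ < T.s₁ + η → IsLocalDiffeomorphAt 𝓘(ℝ, ℂ × ℝ × ℝ) 𝓘(ℝ, 𝔼 4) ∞ T.winS q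
  ldA : ∀ q : ℂ × ℝ × ℝ, q.2 ∈ Adm → T.s₁ - η < ‖q.1‖ → ‖q.1‖ < T.s₂ + η →
    IsLocalDiffeomorphAt 𝓘(ℝ, ℂ × ℝ × ℝ) 𝓘(ℝ, 𝔼 4) ∞ T.winA q
  ldN : ∀ q : ℂ × ℝ × ℝ, q.2 ∈ Adm → T.s₂ - η < ‖q.1‖ → ‖q.1‖ < T.s₃ + η →
    IsLocalDiffeomorphAt 𝓘(ℝ, ℂ × ℝ × ℝ) 𝓘(ℝ, 𝔼 4) ∞ T.winN q
  ldU5 : ∀ q : ℂ × ℝ × ℝ, q.2 ∈ Adm → T.s₃ - η < ‖q.1‖ → ‖q.1‖ < T.s₄ + η →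
    IsLocalDiffeomorphAt 𝓘(ℝ, ℂ × ℝ × ℝ) 𝓘(ℝ, 𝔼 4) ∞ T.winU5 q
  ldU4 : ∀ q : ℂ × ℝ × ℝ, q.2 ∈ Adm → T.s₄ - η < ‖q.1‖ → ‖q.1‖ < T.s₅ + η →
    IsLocalDiffeomorphAt 𝓘(ℝ, ℂ × ℝ × ℝ) 𝓘(ℝ, 𝔼 4) ∞ T.winU4 q
  ldU3 : ∀ q : ℂ × ℝ × ℝ, q.2 ∈ Adm → T.s₅ - η < ‖q.1‖ → ‖q.1‖ < T.s₆ + η →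
    IsLocalDiffeomorphAt 𝓘(ℝ, ℂ × ℝ × ℝ) 𝓘(ℝ, 𝔼 4) ∞ T.winU3 q
  ldU2 : ∀ q : ℂ × ℝ × ℝ, q.2 ∈ Adm → T.s₆ - η < ‖q.1‖ → ‖q.1‖ < T.s₇ + η →
    IsLocalDiffeomorphAt 𝓘(ℝ, ℂ × ℝ × ℝ) 𝓘(ℝ, 𝔼 4) ∞ T.winU2 q
  ldU1 : ∀ q : ℂ × ℝ × ℝ, q.2 ∈ Adm → T.s₇ - η < ‖q.1‖ → ‖q.1‖ < rmax →
    IsLocalDiffeomorphAt 𝓘(ℝ, ℂ × ℝ × ℝ) 𝓘(ℝ, 𝔼 4) ∞ T.winU1 q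

/-- **The tube about Gompf's disc is a local diffeomorphism** at every `(ζ, a, b)` with
`‖ζ‖ < rmax` and admissible offset, under the glue hypotheses. [folklore] -/
theorem isLocalDiffeomorphAt_tubeD {η rmax : ℝ} {Adm : Set (ℝ × ℝ)} (H : T.GlueHyp η rmax Adm) {q : ℂ × ℝ × ℝ}
    (hq : q.2 ∈ Adm) (hr : ‖q.1‖ < rmax) :
    IsLocalDiffeomorphAt 𝓘(ℝ, ℂ × ℝ × ℝ) 𝓘(ℝ, 𝔼 4) ∞ T.tubeD q := by
  have hτ : Continuous fun q : ℂ × ℝ × ℝ ↦ ‖q.1‖ := continuous_norm.comp continuous_fst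
  have hS : IsOpen {q : ℂ × ℝ × ℝ | q.2 ∈ Adm} := H.hAdm.preimage continuous_snd
  have hqS : q ∈ {q : ℂ × ℝ × ℝ | q.2 ∈ Adm} := hq
  unfold tubeD
  refine isLocalDiffeomorphAt_glueBy_of_open hτ H.hη hS hqS (fun q' hq' h ↦ ?_) (fun h ↦ H.ldS q hq (by linarith [H.hη]))
    fun h₁ ↦ ?_
  · rw [H.ag₁ q' hq' h, glueBy_of_lt (τ := fun q : ℂ × ℝ × ℝ ↦ ‖q.1‖)
      (by have := (abs_lt.1 h).2; show ‖q'.1‖ < T.s₂; linarith [H.h12, H.hη])]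
  refine isLocalDiffeomorphAt_glueBy_of_open hτ H.hη hS hqS (fun q' hq' h ↦ ?_) (fun h ↦ H.ldA q hq h₁ (by linarith [H.hη]))
    fun h₂ ↦ ?_
  · rw [H.ag₂ q' hq' h, glueBy_of_lt (τ := fun q : ℂ × ℝ × ℝ ↦ ‖q.1‖)
      (by have := (abs_lt.1 h).2; show ‖q'.1‖ < T.s₃; linarith [H.h23, H.hη])]
  refine isLocalDiffeomorphAt_glueBy_of_open hτ H.hη hS hqS (fun q' hq' h ↦ ?_) (fun h ↦ H.ldN q hq h₂ (by linarith [H.hη]))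
    fun h₃ ↦ ?_
  · rw [H.ag₃ q' hq' h, glueBy_of_lt (τ := fun q : ℂ × ℝ × ℝ ↦ ‖q.1‖)
      (by have := (abs_lt.1 h).2; show ‖q'.1‖ < T.s₄; linarith [H.h34, H.hη])]
  refine isLocalDiffeomorphAt_glueBy_of_open hτ H.hη hS hqS (fun q' hq' h ↦ ?_) (fun h ↦ H.ldU5 q hq h₃ (by linarith [H.hη]))
    fun h₄ ↦ ?_
  · rw [H.ag₄ q' hq' h, glueBy_of_lt (τ := fun q : ℂ × ℝ × ℝ ↦ ‖q.1‖)
      (by have := (abs_lt.1 h).2; show ‖q'.1‖ < T.s₅; linarith [H.h45, H.hη])]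
  refine isLocalDiffeomorphAt_glueBy_of_open hτ H.hη hS hqS (fun q' hq' h ↦ ?_) (fun h ↦ H.ldU4 q hq h₄ (by linarith [H.hη]))
    fun h₅ ↦ ?_
  · rw [H.ag₅ q' hq' h, glueBy_of_lt (τ := fun q : ℂ × ℝ × ℝ ↦ ‖q.1‖)
      (by have := (abs_lt.1 h).2; show ‖q'.1‖ < T.s₆; linarith [H.h56, H.hη])]
  refine isLocalDiffeomorphAt_glueBy_of_open hτ H.hη hS hqS (fun q' hq' h ↦ ?_) (fun h ↦ H.ldU3 q hq h₅ (by linarith [H.hη]))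
    fun h₆ ↦ ?_
  · rw [H.ag₆ q' hq' h, glueBy_of_lt (τ := fun q : ℂ × ℝ × ℝ ↦ ‖q.1‖)
      (by have := (abs_lt.1 h).2; show ‖q'.1‖ < T.s₇; linarith [H.h67, H.hη])]
  exact isLocalDiffeomorphAt_glueBy_of_open hτ H.hη hS hqS (fun q' hq' h ↦ H.ag₇ q' hq' h)
    (fun h ↦ H.ldU2 q hq h₆ (by linarith [H.hη])) fun h₇ ↦ H.ldU1 q hq h₇ hr

end TubeDData

end TubeD

end Literature.Topology.FourManifolds
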